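import Literature.NumberTheory.Transcendental.LinGroupJetArithmetic
import Literature.NumberTheory.Transcendental.LinGroupZEZariski
import Mathlib.Algebra.MvPolynomial.Derivation
import Mathlib.RingTheory.Derivation.Lie
import HarnessLib

/-!
# Words of invariant derivations on `𝔾ₐ^{d₀} × 𝔾ₘ^{d₁}`: translations, box degrees, Leibniz into spans

Topic `Literature/NumberTheory/Transcendental`. Port to `LinGroup d₀ d₁` (index `Fin d₀ ⊕ Fin d₁`)
of the tree's `PhilipponZeroEstimateLeibniz.lean` together with the small part of
`PhilipponZeroEstimateOperators.lean` / `PhilipponZeroEstimateOrder.lean` not already in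
`LinGroupDerivations.lean` (prepending a letter, commutation of the `D_w`, invariance of the `D_w`
under translations). Formal facts about the invariant derivations `D_w` (`LinGroup.invDeriv`) and
the words `D_{u₁} ⋯ D_{u_k}` (`LinGroup.wordDeriv`) on `ℂ[X, Y]`, used by the ideal-theoretic half
of the zero estimate (Nesterenko–Philippon (eds.), LNM 1752, Ch. 11, Lemma 3.3 and Prop. 3.6 (ii)).
Everything is PROVED.

* `LinGroup.wordDeriv_cons`, `LinGroup.VanishesToOrder.mul_left`, `LinGroup.invDeriv_comm`, `LinGroup.shift_invDeriv`,
  `LinGroup.shift_wordDeriv` (Roy (92): `∂(f ∘ τ_σ) = (∂ f) ∘ τ_σ`);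
* `LinGroup.invDeriv_mem_Box` / `wordDeriv_mem_Box` (from `LinGroup.invDeriv_monomial` of
  `LinGroupJetArithmetic.lean`);
* `LinGroup.wordsLE W N g`, `wordDeriv_mem_wordsLE`, **Leibniz into spans**
  `wordDeriv_mul_mem_span`, `wordDeriv_mul_sub_mem_span`;
* `invDeriv_torusUnit`, `torusUnit_pow_mul_wordDeriv_mem_span`.

## References

* Yu. V. Nesterenko, P. Philippon (eds.), *Introduction to Algebraic Independence Theory*,
  LNM 1752 (2001), Ch. 11 (D. Roy), §3: (92), Lemma 3.3, Def. 3.5, Prop. 3.6 (ii).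
  [NesterenkoPhilippon2001]
* P. Philippon, *Lemmes de zéros dans les groupes algébriques commutatifs*, Bull. Soc. Math.
  France 114 (1986), 355–383, §4. [Philippon1986]
-/

noncomputable section

open MvPolynomial

namespace Literature.NumberTheory.Transcendental

namespace LinGroup

variable {d₀ d₁ : ℕ}

/-! ### Prepending a letter; commutation; invariance under translations -/

/-- Prepending a letter: `wordDeriv (e, t) P = D_e (wordDeriv t P)`. [folklore] -/
theorem wordDeriv_cons {j : ℕ} (e : (Fin d₀ → ℂ) × (Fin d₁ → ℂ)) (t : Fin j → (Fin d₀ → ℂ) × (Fin d₁ → ℂ))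
    (P : MvPolynomial (Fin d₀ ⊕ Fin d₁) ℂ) :
    wordDeriv (Fin.cons e t : Fin (j + 1) → (Fin d₀ → ℂ) × (Fin d₁ → ℂ)) P = invDeriv e (wordDeriv t P) := by
  induction j generalizing P with
  | zero =>
    rw [wordDeriv_succ]
    have h1 : (Fin.cons e t : Fin (0 + 1) → (Fin d₀ → ℂ) × (Fin d₁ → ℂ)) (Fin.last 0) = e := rfl
    rw [h1]
    rfl
  | succ j ih =>
    rw [wordDeriv_succ]
    have h1 : (Fin.cons e t : Fin (j + 1 + 1) → (Fin d₀ → ℂ) × (Fin d₁ → ℂ)) (Fin.last (j + 1)) = t (Fin.last j) := by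
      rw [← Fin.succ_last, Fin.cons_succ]
    have h2 : Fin.init (Fin.cons e t : Fin (j + 1 + 1) → (Fin d₀ → ℂ) × (Fin d₁ → ℂ)) =
        Fin.cons e (Fin.init t) := by
      funext i
      refine Fin.cases ?_ (fun i' => ?_) i
      · rfl
      · simp only [Fin.init, Fin.cons_succ, Fin.castSucc_succ]
    rw [h1, h2, ih]
    rfl

/-- Words and left multiplication, in the weak form we need: if every word of length `< N` in
letters from `W` kills `P` at `g`, the same holds for `a · P` (Leibniz). [folklore] -/
theorem evalAt_wordDeriv_mul_eq_zero {P : MvPolynomial (Fin d₀ ⊕ Fin d₁) ℂ}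
    {W : Submodule ℂ ((Fin d₀ → ℂ) × (Fin d₁ → ℂ))} {g : LinGroup d₀ d₁} {N : ℕ}
    (h : ∀ k < N, ∀ u : Fin k → (Fin d₀ → ℂ) × (Fin d₁ → ℂ), (∀ i, u i ∈ W) → evalAt (wordDeriv u P) g = 0)
    (a : MvPolynomial (Fin d₀ ⊕ Fin d₁) ℂ) :
    ∀ k < N, ∀ u : Fin k → (Fin d₀ → ℂ) × (Fin d₁ → ℂ), (∀ i, u i ∈ W) → evalAt (wordDeriv u (a * P)) g = 0 := by
  -- strengthen: for every `Q` obtained from `P` by a word of length `j` with `j + k < N`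
  suffices H : ∀ (k : ℕ) (u : Fin k → (Fin d₀ → ℂ) × (Fin d₁ → ℂ)), (∀ i, u i ∈ W) →
      ∀ (b : MvPolynomial (Fin d₀ ⊕ Fin d₁) ℂ) {j : ℕ} (t : Fin j → (Fin d₀ → ℂ) × (Fin d₁ → ℂ)), (∀ i, t i ∈ W) →
      j + k < N → evalAt (wordDeriv u (b * wordDeriv t P)) g = 0 by
    intro k hk u hu
    simpa using H k u hu a (j := 0) Fin.elim0 (fun i => i.elim0) (by simpa using hk)
  intro k
  induction k with
  | zero =>
    intro u _ b j t ht hj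
    simp only [wordDeriv_zero, evalAt, map_mul]
    have := h j (by simpa using hj) t ht
    rw [evalAt] at this
    rw [this, mul_zero]
  | succ k ih =>
    intro u hu b j t ht hj
    rw [wordDeriv_succ, Derivation.leibniz, smul_eq_mul, smul_eq_mul, wordDeriv_add]
    have hu' : ∀ i, Fin.init u i ∈ W := fun i => hu _
    have e1 : evalAt (wordDeriv (Fin.init u) (b * invDeriv (u (Fin.last k)) (wordDeriv t P))) g = 0 := by
      have := ih (Fin.init u) hu' b (j := j + 1) (Fin.cons (u (Fin.last k)) t) (by
        intro i
        refine Fin.cases ?_ (fun i' => ?_) i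
        · simpa using hu (Fin.last k)
        · simpa using ht i') (by omega)
      rwa [wordDeriv_cons] at this
    have e2 : evalAt (wordDeriv (Fin.init u) (invDeriv (u (Fin.last k)) b * wordDeriv t P)) g = 0 :=
      ih (Fin.init u) hu' _ t ht (by omega)
    rw [mul_comm (wordDeriv t P), evalAt, map_add, ← evalAt, ← evalAt, e1, e2, add_zero]

/-- **Ideal closure**: if `P` vanishes to order `≥ N` at `g` along `exp_G(W)`, so does `a · P` for
every polynomial `a` (the functions vanishing to order `≥ N` at a point form an ideal; Roy, §3.2).
[cite: NesterenkoPhilippon2001, Ch. 11 §3.2] -/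
theorem VanishesToOrder.mul_left {P : MvPolynomial (Fin d₀ ⊕ Fin d₁) ℂ}
    {W : Submodule ℂ ((Fin d₀ → ℂ) × (Fin d₁ → ℂ))} {g : LinGroup d₀ d₁} {N : ℕ} (h : VanishesToOrder P W g N)
    (a : MvPolynomial (Fin d₀ ⊕ Fin d₁) ℂ) : VanishesToOrder (a * P) W g N := by
  rw [vanishesToOrder_iff_wordDeriv] at h ⊢
  exact evalAt_wordDeriv_mul_eq_zero h a

/-- **The invariant derivations commute**: `D_w D_{w'} = D_{w'} D_w` (they are `ℂ`-combinations of
the pairwise commuting `∂/∂X_i`, `Y_l ∂/∂Y_l`; checked on the generators). [folklore] -/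
theorem invDeriv_comm (w w' : (Fin d₀ → ℂ) × (Fin d₁ → ℂ)) (P : MvPolynomial (Fin d₀ ⊕ Fin d₁) ℂ) :
    invDeriv w (invDeriv w' P) = invDeriv w' (invDeriv w P) := by
  have h : ⁅invDeriv (d₀ := d₀) (d₁ := d₁) w, invDeriv w'⁆ = 0 := by
    refine MvPolynomial.derivation_ext fun v => ?_
    rw [Derivation.commutator_apply, Derivation.zero_apply]
    rcases v with i | l
    · simp
    · simp only [invDeriv_X_inr, Derivation.leibniz, invDeriv_C, smul_eq_mul]
      ring
  have := congrArg (fun D : Derivation ℂ (MvPolynomial (Fin d₀ ⊕ Fin d₁) ℂ) (MvPolynomial (Fin d₀ ⊕ Fin d₁) ℂ) => D P) h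
  simp only [Derivation.commutator_apply, Derivation.zero_apply, sub_eq_zero] at this
  exact this

/-- Words do not depend on the order of their letters: swapping two adjacent letters. [folklore] -/
theorem wordDeriv_cons_cons_comm {k : ℕ} (e e' : (Fin d₀ → ℂ) × (Fin d₁ → ℂ)) (u : Fin k → (Fin d₀ → ℂ) × (Fin d₁ → ℂ))
    (P : MvPolynomial (Fin d₀ ⊕ Fin d₁) ℂ) :
    wordDeriv (Fin.cons e (Fin.cons e' u) : Fin (k + 1 + 1) → _) P =
      wordDeriv (Fin.cons e' (Fin.cons e u) : Fin (k + 1 + 1) → _) P := by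
  rw [wordDeriv_cons, wordDeriv_cons, wordDeriv_cons, wordDeriv_cons, invDeriv_comm]

/-- **Invariance of `D_w` under translations** (Roy (92): `∂(f ∘ τ_σ) = (∂f) ∘ τ_σ`):
`τ_g (D_w P) = D_w (τ_g P)` (checked on generators: `D_w X_i`, `D_w Y_l / Y_l` are constants).
[cite: NesterenkoPhilippon2001, Ch. 11 (92)] -/
theorem shift_invDeriv (g : LinGroup d₀ d₁) (w : (Fin d₀ → ℂ) × (Fin d₁ → ℂ)) (P : MvPolynomial (Fin d₀ ⊕ Fin d₁) ℂ) :
    shift g (invDeriv w P) = invDeriv w (shift g P) := by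
  induction P using MvPolynomial.induction_on with
  | C a => simp
  | add p q hp hq => rw [map_add, map_add, map_add, map_add, hp, hq]
  | mul_X p v ih =>
    rw [Derivation.leibniz, map_mul, Derivation.leibniz, smul_eq_mul, smul_eq_mul, smul_eq_mul, smul_eq_mul,
      map_add, map_mul, map_mul, ih]
    congr 1
    rcases v with i | l
    · simp
    · simp only [invDeriv_X_inr, shift_X_inr, map_mul, shift_C, Derivation.leibniz, invDeriv_C, smul_eq_mul]
      ring

/-- Translations commute with words: `τ_g (wordDeriv u P) = wordDeriv u (τ_g P)`. [folklore] -/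
theorem shift_wordDeriv (g : LinGroup d₀ d₁) {k : ℕ} (u : Fin k → (Fin d₀ → ℂ) × (Fin d₁ → ℂ))
    (P : MvPolynomial (Fin d₀ ⊕ Fin d₁) ℂ) : shift g (wordDeriv u P) = wordDeriv u (shift g P) := by
  induction k generalizing P with
  | zero => rfl
  | succ k ih => rw [wordDeriv_succ, wordDeriv_succ, ih, shift_invDeriv]

/-! ### Box degrees are preserved (via `invDeriv_monomial` of `LinGroupJetArithmetic.lean`) -/

/-- `D_w` preserves the box pieces `Box(t)` (it does not raise partial degrees). [folklore] -/
theorem invDeriv_mem_Box {D₀ D₁ t : ℕ} (w : (Fin d₀ → ℂ) × (Fin d₁ → ℂ)) {P : MvPolynomial (Fin d₀ ⊕ Fin d₁) ℂ}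
    (hP : P ∈ Box D₀ D₁ t) : invDeriv w P ∈ Box D₀ D₁ t := by
  classical
  have hsupp : ∀ s ∈ P.support, s ∈ boxSet (d₀ := d₀) (d₁ := d₁) D₀ D₁ t :=
    fun s hs => (mem_restrictSupport_iff ℂ).mp hP hs
  -- a monomial with exponent in the box lies in the box
  have hmono : ∀ (s : (Fin d₀ ⊕ Fin d₁) →₀ ℕ) (c : ℂ), s ∈ boxSet (d₀ := d₀) (d₁ := d₁) D₀ D₁ t →
      monomial s c ∈ Box (d₀ := d₀) (d₁ := d₁) D₀ D₁ t := fun s c hs =>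
    (mem_restrictSupport_iff ℂ).mpr fun s' hs' => by
      rw [Finset.mem_coe] at hs'
      rwa [Finset.mem_singleton.mp (support_monomial_subset hs')]
  rw [P.as_sum, map_sum]
  refine Submodule.sum_mem _ fun s hs => ?_
  rw [invDeriv_monomial]
  refine Submodule.add_mem _ (Submodule.sum_mem _ fun i _ => Submodule.smul_mem _ _ (hmono _ _ fun v => ?_))
    (Submodule.smul_mem _ _ (hmono _ _ (hsupp s hs)))
  rw [Finsupp.tsub_apply]
  exact (Nat.sub_le _ _).trans (hsupp s hs v)

/-- Words preserve the box pieces. [folklore] -/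
theorem wordDeriv_mem_Box {D₀ D₁ t k : ℕ} (u : Fin k → (Fin d₀ → ℂ) × (Fin d₁ → ℂ))
    {P : MvPolynomial (Fin d₀ ⊕ Fin d₁) ℂ} (hP : P ∈ Box D₀ D₁ t) : wordDeriv u P ∈ Box D₀ D₁ t := by
  induction k generalizing P with
  | zero => exact hP
  | succ k ih =>
    rw [wordDeriv_succ]
    exact ih _ (invDeriv_mem_Box _ hP)

/-! ### Sets of words applied to a polynomial -/

/-- `wordsLE W N g = {D_{u₁} ⋯ D_{u_j} g ; j ≤ N, uᵢ ∈ W}` — all words of length `≤ N` in letters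
from `W` applied to `g` (Roy's `∂^κ g`, `|κ| ≤ N`, basis-free). [cite: NesterenkoPhilippon2001, Ch. 11 Def. 3.5] -/
def wordsLE (W : Submodule ℂ ((Fin d₀ → ℂ) × (Fin d₁ → ℂ))) (N : ℕ) (g : MvPolynomial (Fin d₀ ⊕ Fin d₁) ℂ) :
    Set (MvPolynomial (Fin d₀ ⊕ Fin d₁) ℂ) :=
  {Q | ∃ j, j ≤ N ∧ ∃ u : Fin j → (Fin d₀ → ℂ) × (Fin d₁ → ℂ), (∀ i, u i ∈ W) ∧ Q = wordDeriv u g}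

/-- `g` itself is the empty word. [folklore] -/
theorem self_mem_wordsLE (W : Submodule ℂ ((Fin d₀ → ℂ) × (Fin d₁ → ℂ))) (N : ℕ)
    (g : MvPolynomial (Fin d₀ ⊕ Fin d₁) ℂ) : g ∈ wordsLE W N g :=
  ⟨0, Nat.zero_le _, Fin.elim0, fun i => i.elim0, rfl⟩

/-- `wordsLE` is monotone in the length bound. [folklore] -/
theorem wordsLE_mono (W : Submodule ℂ ((Fin d₀ → ℂ) × (Fin d₁ → ℂ))) {N N' : ℕ} (h : N ≤ N')
    (g : MvPolynomial (Fin d₀ ⊕ Fin d₁) ℂ) : wordsLE W N g ⊆ wordsLE W N' g := by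
  rintro _ ⟨j, hj, u, hu, rfl⟩
  exact ⟨j, hj.trans h, u, hu, rfl⟩

/-- **Composition of words**: a word of length `k` applied to a word of length `≤ N` applied to
`g` is a word of length `≤ k + N` applied to `g` (Roy, Lemma 3.3). [cite: NesterenkoPhilippon2001, Ch. 11 Lemma 3.3] -/
theorem wordDeriv_mem_wordsLE {W : Submodule ℂ ((Fin d₀ → ℂ) × (Fin d₁ → ℂ))} {N k : ℕ}
    {g Q : MvPolynomial (Fin d₀ ⊕ Fin d₁) ℂ} (hQ : Q ∈ wordsLE W N g)
    (v : Fin k → (Fin d₀ → ℂ) × (Fin d₁ → ℂ)) (hv : ∀ i, v i ∈ W) : wordDeriv v Q ∈ wordsLE W (k + N) g := by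
  induction k generalizing Q with
  | zero => simpa using hQ
  | succ k ih =>
    -- split off the outermost letter `v 0`
    have hsplit : v = Fin.cons (v 0) (Fin.tail v) := (Fin.cons_self_tail v).symm
    rw [hsplit, wordDeriv_cons]
    obtain ⟨j, hj, u, hu, hju⟩ := ih hQ (Fin.tail v) (fun i => hv _)
    rw [hju, ← wordDeriv_cons]
    exact ⟨j + 1, by omega, Fin.cons (v 0) u, fun i => Fin.cases (hv 0) (fun i' => hu i') i, rfl⟩

/-- In particular single letters: `D_e (wordsLE W N g) ⊆ wordsLE W (N+1) g`. [folklore] -/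
theorem invDeriv_mem_wordsLE {W : Submodule ℂ ((Fin d₀ → ℂ) × (Fin d₁ → ℂ))} {N : ℕ}
    {g Q : MvPolynomial (Fin d₀ ⊕ Fin d₁) ℂ} (hQ : Q ∈ wordsLE W N g) {e : (Fin d₀ → ℂ) × (Fin d₁ → ℂ)}
    (he : e ∈ W) : invDeriv e Q ∈ wordsLE W (N + 1) g := by
  have h := wordDeriv_mem_wordsLE hQ (Fin.cons e Fin.elim0 : Fin 1 → _)
    (fun i => Fin.cases he (fun i' => i'.elim0) i)
  rw [wordDeriv_cons, wordDeriv_zero, show 0 + 1 + N = N + 1 by omega] at h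
  exact h

/-! ### Leibniz into spans -/

/-- A derivation maps the ideal generated by `wordsLE W N g` into the ideal generated by
`wordsLE W (N+1) g`. [folklore] -/
theorem invDeriv_mem_span_wordsLE_succ {W : Submodule ℂ ((Fin d₀ → ℂ) × (Fin d₁ → ℂ))} {N : ℕ}
    {g R : MvPolynomial (Fin d₀ ⊕ Fin d₁) ℂ} (hR : R ∈ Ideal.span (wordsLE W N g))
    {e : (Fin d₀ → ℂ) × (Fin d₁ → ℂ)} (he : e ∈ W) : invDeriv e R ∈ Ideal.span (wordsLE W (N + 1) g) := by
  refine Submodule.span_induction (p := fun R _ => invDeriv e R ∈ Ideal.span (wordsLE W (N + 1) g))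
    ?_ ?_ ?_ ?_ hR
  · intro Q hQ
    exact Ideal.subset_span (invDeriv_mem_wordsLE hQ he)
  · simp
  · intro x y _ _ hx hy
    rw [map_add]
    exact Ideal.add_mem _ hx hy
  · intro a x hx hx'
    rw [smul_eq_mul, Derivation.leibniz, smul_eq_mul, smul_eq_mul]
    exact Ideal.add_mem _ (Ideal.mul_mem_left _ _ hx')
      (Ideal.mul_mem_right _ _ (Ideal.span_mono (wordsLE_mono W (Nat.le_succ N) g) hx))

/-- **Leibniz into spans**: for a word `v` of length `k` in letters from `W` and any `a`,
`D_v(a · g) ∈ (wordsLE W k g)`, the ideal generated by the words of length `≤ k` applied to `g`.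
(Roy, proof of Prop. 3.6 (ii): "the formulas for differentiating a product".)
[cite: NesterenkoPhilippon2001, Ch. 11 Prop. 3.6 (ii)] -/
theorem wordDeriv_mul_mem_span {W : Submodule ℂ ((Fin d₀ → ℂ) × (Fin d₁ → ℂ))} {k : ℕ}
    (v : Fin k → (Fin d₀ → ℂ) × (Fin d₁ → ℂ)) (hv : ∀ i, v i ∈ W) (a g : MvPolynomial (Fin d₀ ⊕ Fin d₁) ℂ) :
    wordDeriv v (a * g) ∈ Ideal.span (wordsLE W k g) := by
  induction k generalizing a with
  | zero =>
    rw [wordDeriv_zero]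
    exact Ideal.mul_mem_left _ a (Ideal.subset_span (self_mem_wordsLE W 0 g))
  | succ k ih =>
    have hsplit : v = Fin.cons (v 0) (Fin.tail v) := (Fin.cons_self_tail v).symm
    rw [hsplit, wordDeriv_cons]
    exact invDeriv_mem_span_wordsLE_succ (ih (Fin.tail v) (fun i => hv _) a) (hv 0)

/-- Precise Leibniz for a word against a factor `a`: `D_v(a·g) - a·D_v g` lies in the ideal
generated by the products `(D_{v'} a) · (D_{v''} g)` with `|v''| < |v|` — recorded in the weak form
`D_v(a·g) - a·D_v g ∈ (wordsLE W (k-1) g)` for `k ≥ 1`. [folklore] -/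
theorem wordDeriv_mul_sub_mem_span {W : Submodule ℂ ((Fin d₀ → ℂ) × (Fin d₁ → ℂ))} {k : ℕ}
    (v : Fin (k + 1) → (Fin d₀ → ℂ) × (Fin d₁ → ℂ)) (hv : ∀ i, v i ∈ W) (a g : MvPolynomial (Fin d₀ ⊕ Fin d₁) ℂ) :
    wordDeriv v (a * g) - a * wordDeriv v g ∈ Ideal.span (wordsLE W k g) := by
  induction k generalizing a with
  | zero =>
    have hv1 : v = Fin.cons (v 0) Fin.elim0 := by
      funext i; refine Fin.cases rfl (fun j => j.elim0) i
    rw [hv1, wordDeriv_cons, wordDeriv_cons, wordDeriv_zero, wordDeriv_zero, Derivation.leibniz,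
      smul_eq_mul, smul_eq_mul, add_sub_cancel_left]
    exact Ideal.mul_mem_right _ _ (Ideal.subset_span (self_mem_wordsLE W 0 g))
  | succ k ih =>
    have hsplit : v = Fin.cons (v 0) (Fin.tail v) := (Fin.cons_self_tail v).symm
    rw [hsplit, wordDeriv_cons, wordDeriv_cons]
    set e := v 0 with he
    set v' := Fin.tail v with hv'
    have hv'W : ∀ i, v' i ∈ W := fun i => hv _
    -- `D_{v'}(a g) = a D_{v'} g + r`, `r ∈ (wordsLE W k g)`
    have hr := ih v' hv'W a
    set r := wordDeriv v' (a * g) - a * wordDeriv v' g with hr_def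
    have hexp : wordDeriv v' (a * g) = a * wordDeriv v' g + r := by rw [hr_def]; ring
    rw [hexp, map_add, Derivation.leibniz, smul_eq_mul, smul_eq_mul]
    have e1 : a * invDeriv e (wordDeriv v' g) + wordDeriv v' g * invDeriv e a + invDeriv e r -
        a * invDeriv e (wordDeriv v' g) = wordDeriv v' g * invDeriv e a + invDeriv e r := by ring
    rw [e1]
    refine Ideal.add_mem _ (Ideal.mul_mem_right _ _ (Ideal.subset_span ?_))
      (invDeriv_mem_span_wordsLE_succ hr (hv 0))
    exact ⟨k + 1, le_rfl, v', hv'W, rfl⟩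

/-! ### Eigen-elements: the torus unit and saturation -/

/-- `D_w u = (∑_l v_l) u` for the torus unit `u = Y₁⋯Y_{d₁}`. [folklore] -/
theorem invDeriv_torusUnit (w : (Fin d₀ → ℂ) × (Fin d₁ → ℂ)) :
    invDeriv w (torusUnit d₀ d₁) = (∑ l : Fin d₁, w.2 l) • torusUnit d₀ d₁ := by
  classical
  have key : ∀ s : Finset (Fin d₁), invDeriv w (∏ l ∈ s, X (Sum.inr l)) =
      (∑ l ∈ s, w.2 l) • ∏ l ∈ s, (X (Sum.inr l) : MvPolynomial (Fin d₀ ⊕ Fin d₁) ℂ) := by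
    intro s
    induction s using Finset.induction_on with
    | empty => simp
    | insert a s ha ih =>
      rw [Finset.prod_insert ha, Finset.sum_insert ha, Derivation.leibniz, ih, invDeriv_X_inr,
        smul_eq_mul, smul_eq_mul, add_smul, MvPolynomial.smul_eq_C_mul, MvPolynomial.smul_eq_C_mul,
        MvPolynomial.smul_eq_C_mul]
      ring
  exact key Finset.univ

/-- `D_w u^k = k (∑_l v_l) u^k`. [folklore] -/
theorem invDeriv_torusUnit_pow (w : (Fin d₀ → ℂ) × (Fin d₁ → ℂ)) (k : ℕ) :
    invDeriv w (torusUnit d₀ d₁ ^ k) = ((k : ℂ) * ∑ l : Fin d₁, w.2 l) • torusUnit d₀ d₁ ^ k := by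
  induction k with
  | zero => simp
  | succ k ih =>
    rw [pow_succ, Derivation.leibniz, ih, invDeriv_torusUnit]
    simp only [smul_eq_mul, MvPolynomial.smul_eq_C_mul, map_mul, map_natCast, Nat.cast_succ,
      map_add, map_one]
    ring

/-- `wordsLT W k g` — the words of length `< k` in letters from `W` applied to `g`. [folklore] -/
def wordsLT (W : Submodule ℂ ((Fin d₀ → ℂ) × (Fin d₁ → ℂ))) (k : ℕ) (g : MvPolynomial (Fin d₀ ⊕ Fin d₁) ℂ) :
    Set (MvPolynomial (Fin d₀ ⊕ Fin d₁) ℂ) :=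
  {Q | ∃ j, j < k ∧ ∃ u : Fin j → (Fin d₀ → ℂ) × (Fin d₁ → ℂ), (∀ i, u i ∈ W) ∧ Q = wordDeriv u g}

/-- `D_e` maps the `ℂ`-span of `wordsLT W k g` into that of `wordsLT W (k+1) g`, for `e ∈ W`.
[folklore] -/
theorem invDeriv_mem_span_wordsLT_succ {W : Submodule ℂ ((Fin d₀ → ℂ) × (Fin d₁ → ℂ))} {k : ℕ}
    {g R : MvPolynomial (Fin d₀ ⊕ Fin d₁) ℂ} (hR : R ∈ Submodule.span ℂ (wordsLT W k g))
    {e : (Fin d₀ → ℂ) × (Fin d₁ → ℂ)} (he : e ∈ W) : invDeriv e R ∈ Submodule.span ℂ (wordsLT W (k + 1) g) := by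
  refine Submodule.span_induction (p := fun R _ => invDeriv e R ∈ Submodule.span ℂ (wordsLT W (k + 1) g))
    ?_ ?_ ?_ ?_ hR
  · rintro _ ⟨j, hj, u, hu, rfl⟩
    refine Submodule.subset_span ⟨j + 1, by omega, Fin.cons e u,
      fun i => Fin.cases he (fun i' => hu i') i, ?_⟩
    rw [wordDeriv_cons]
  · simp
  · intro x y _ _ hx hy
    rw [map_add]; exact Submodule.add_mem _ hx hy
  · intro c x _ hx
    rw [Derivation.map_smul]; exact Submodule.smul_mem _ _ hx

/-- Words against an eigen-element: if `D_w a ∈ ℂ a` for all `w`, then for every word `v` of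
length `k`, `D_v(a g) = a · (D_v g + R)` with `R` a `ℂ`-combination of shorter words (in the
letters of `W`) applied to `g`. [folklore] -/
theorem wordDeriv_eigen_mul {W : Submodule ℂ ((Fin d₀ → ℂ) × (Fin d₁ → ℂ))} {a : MvPolynomial (Fin d₀ ⊕ Fin d₁) ℂ}
    (ha : ∀ w : (Fin d₀ → ℂ) × (Fin d₁ → ℂ), ∃ c : ℂ, invDeriv w a = c • a) {k : ℕ}
    (v : Fin k → (Fin d₀ → ℂ) × (Fin d₁ → ℂ)) (hv : ∀ i, v i ∈ W) (g : MvPolynomial (Fin d₀ ⊕ Fin d₁) ℂ) :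
    ∃ R ∈ Submodule.span ℂ (wordsLT W k g), wordDeriv v (a * g) = a * (wordDeriv v g + R) := by
  induction k with
  | zero => exact ⟨0, Submodule.zero_mem _, by simp⟩
  | succ k ih =>
    have hsplit : v = Fin.cons (v 0) (Fin.tail v) := (Fin.cons_self_tail v).symm
    obtain ⟨R', hR', hR'eq⟩ := ih (Fin.tail v) (fun i => hv _)
    obtain ⟨c, hc⟩ := ha (v 0)
    -- `D_e (a (D_{v'} g + R')) = c a (…) + a (D_e D_{v'} g + D_e R')`
    refine ⟨c • (wordDeriv (Fin.tail v) g + R') + invDeriv (v 0) R', ?_, ?_⟩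
    · refine Submodule.add_mem _ (Submodule.smul_mem _ _ (Submodule.add_mem _
        (Submodule.subset_span ⟨k, Nat.lt_succ_self k, Fin.tail v, fun i => hv _, rfl⟩)
        (Submodule.span_mono ?_ hR'))) (invDeriv_mem_span_wordsLT_succ hR' (hv 0))
      rintro _ ⟨j, hj, u, hu, rfl⟩
      exact ⟨j, by omega, u, hu, rfl⟩
    · rw [hsplit, wordDeriv_cons, wordDeriv_cons, hR'eq, Derivation.leibniz, hc, map_add]
      simp only [smul_eq_mul, Fin.cons_zero, Fin.tail_cons]
      rw [MvPolynomial.smul_eq_C_mul, MvPolynomial.smul_eq_C_mul]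
      ring

/-- **Saturation compatibility of words**: `u^k · D_v g` is a `ℂ`-combination of the words of
length `≤ |v|` applied to `u^k g` (`u = Y₁⋯Y_{d₁}` the torus unit). [folklore] -/
theorem torusUnit_pow_mul_wordDeriv_mem_span {W : Submodule ℂ ((Fin d₀ → ℂ) × (Fin d₁ → ℂ))} (k : ℕ) {j : ℕ}
    (v : Fin j → (Fin d₀ → ℂ) × (Fin d₁ → ℂ)) (hv : ∀ i, v i ∈ W) (g : MvPolynomial (Fin d₀ ⊕ Fin d₁) ℂ) :
    torusUnit d₀ d₁ ^ k * wordDeriv v g ∈ Submodule.span ℂ (wordsLE W j (torusUnit d₀ d₁ ^ k * g)) := by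
  -- strong induction on the length `j`
  induction j using Nat.strong_induction_on generalizing g with
  | _ j ih =>
    have ha : ∀ w : (Fin d₀ → ℂ) × (Fin d₁ → ℂ), ∃ c : ℂ, invDeriv w (torusUnit d₀ d₁ ^ k) = c • torusUnit d₀ d₁ ^ k :=
      fun w => ⟨_, invDeriv_torusUnit_pow w k⟩
    obtain ⟨R, hR, hReq⟩ := wordDeriv_eigen_mul ha v hv g
    -- `u^k D_v g = D_v(u^k g) - u^k R`
    have e1 : torusUnit d₀ d₁ ^ k * wordDeriv v g =
        wordDeriv v (torusUnit d₀ d₁ ^ k * g) - torusUnit d₀ d₁ ^ k * R := by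
      rw [hReq]; ring
    rw [e1]
    refine Submodule.sub_mem _ (Submodule.subset_span ⟨j, le_rfl, v, hv, rfl⟩) ?_
    -- `u^k R` with `R` in the span of shorter words: induction hypothesis termwise
    refine Submodule.span_induction (p := fun R _ => torusUnit d₀ d₁ ^ k * R ∈
        Submodule.span ℂ (wordsLE W j (torusUnit d₀ d₁ ^ k * g))) ?_ ?_ ?_ ?_ hR
    · rintro _ ⟨j', hj', v', hv', rfl⟩
      exact Submodule.span_mono (wordsLE_mono W hj'.le _) (ih j' hj' v' hv' g)
    · simp
    · intro x y _ _ hx hy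
      rw [mul_add]; exact Submodule.add_mem _ hx hy
    · intro c x _ hx
      rw [mul_smul_comm]; exact Submodule.smul_mem _ _ hx

end LinGroup

end Literature.NumberTheory.Transcendental
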